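import Summits.NavierStokesRegularity.FunctionalMining.CrossedShearPressure
import Summits.NavierStokesRegularity.FunctionalMining.PressureMomentRateRpow
import HarnessLib

/-!
# FunctionalMining — kernel no-go: the pressure-moment rows `EP.p.q|T_LD|G1` are FALSE ∀κ for every real `q ≥ 2` (W11)

Search for candidate a priori estimates; no regularity claim. Cell `pub-nsfunc`, prove seat
(gen 10). SIEVELD §2, Corollary W11 for the cores `∫|p|^q`, real `q ≥ 2` (rows `EP.p.q=2`, `EP.p.q=3`):
at the reciprocal crossed shear `u_β` (`CrossedShearPressure`: `π_{u_β} = cc = cos2πx₀ cos2πx₁`,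
viscous source `A = −8π² h_β(x₂) cc`), the inverse Laplacian is explicit because
`h_β = 4π²(β²−2) − 4π²β² cos4πx₂` is a trigonometric polynomial:

`Δ⁻¹(h_β(x₂) cc) = g_β(x₂) cc`, `g_β(t) = −(β²−2)/2 + (β²/6) cos 4πt` (`g_β″ − 8π² g_β = h_β`),

so the viscous rate of `∫|π|^q` (`pressureRpowViscousRate`, `PressureMomentRateRpow`) is
`V_q(u_β) = −8π² q ∫ g_β(x₂) (cc²)^{q/2} = 4π² q (β² − 2) m_q²`, `m_q = ∫_T (cos²2πt)^{q/2} > 0`.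
For `β = 2`: `V_q = 8π² q m_q² > 0`, and Theorem H (`HeatSieve`) kills `SaturatingLaw (∫|π|^q) σ γ κ`
for every `κ`, `σ`, `γ ≥ 0` — in particular the K0 rows `EP.p.q=2|T_LD|G1` (again) and
`EP.p.q=3|T_LD|G1` (`σ = 3`, `γ = 3`). Explicit-witness no-go; nothing about regularity.
-/

noncomputable section

open MeasureTheory Set Filter Topology Real
open scoped InnerProductSpace ContDiff

namespace Summit.NavierStokesRegularity.FunctionalMining

open Literature.Analysis Literature.Analysis.FunctionSpaces Literature.Analysis.FunctionSpaces.Torus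
open Literature.Analysis.FluidPDE

namespace CrossedShear

/-! ## 1. The profile `g_β` and `g_β″ − 8π² g_β = h_β` -/

/-- `cos 4πt` as a profile. [folklore] -/
def cos2P : ShearProfile where
  toFun := fun t => Real.cos (4 * π * t)
  periodic' := fun t => by
    show Real.cos (4 * π * (t + 1)) = Real.cos (4 * π * t)
    rw [mul_add, mul_one, show (4 : ℝ) * π = 2 * π + 2 * π by ring,
      ← add_assoc, Real.cos_add_two_pi, Real.cos_add_two_pi]
  contDiff' := Real.contDiff_cos.comp (contDiff_const.mul contDiff_id)

/-- Values of `cos2P`. [folklore] -/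
@[simp] theorem cos2P_apply (t : ℝ) : cos2P t = Real.cos (4 * π * t) := rfl

/-- `(cos 4πt)' = −4π sin 4πt`. [folklore] -/
theorem hasDerivAt_cos2P (t : ℝ) : HasDerivAt (cos2P : ℝ → ℝ) (-(4 * π * Real.sin (4 * π * t))) t := by
  have h : HasDerivAt (fun x : ℝ => Real.cos (4 * π * x)) (-Real.sin (4 * π * t) * (4 * π * 1)) t :=
    ((hasDerivAt_id t).const_mul (4 * π)).cos
  have e : -Real.sin (4 * π * t) * (4 * π * 1) = -(4 * π * Real.sin (4 * π * t)) := by ring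
  rw [e] at h
  exact h

/-- `(cos 4πt)'' = −16π² cos 4πt`. [folklore] -/
theorem deriv_deriv_cos2P (t : ℝ) : deriv (deriv cos2P) t = -(16 * π ^ 2) * cos2P t := by
  have hfun : deriv (cos2P : ℝ → ℝ) = fun x => -(4 * π * Real.sin (4 * π * x)) :=
    funext fun x => (hasDerivAt_cos2P x).deriv
  rw [hfun]
  have h : HasDerivAt (fun x : ℝ => -(4 * π * Real.sin (4 * π * x)))
      (-(4 * π * (Real.cos (4 * π * t) * (4 * π * 1)))) t :=
    (((hasDerivAt_id t).const_mul (4 * π)).sin.const_mul (4 * π)).neg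
  rw [h.deriv, cos2P_apply]
  ring

/-- `g_β(t) = −(β²−2)/2 + (β²/6) cos 4πt`. [ours; bookkeeping] -/
def gP (β : ℝ) : ShearProfile where
  toFun := fun t => -((β ^ 2 - 2) / 2) + β ^ 2 / 6 * cos2P t
  periodic' := fun t => by
    show -((β ^ 2 - 2) / 2) + β ^ 2 / 6 * cos2P (t + 1) = -((β ^ 2 - 2) / 2) + β ^ 2 / 6 * cos2P t
    rw [cos2P.periodic t]
  contDiff' := contDiff_const.add (contDiff_const.mul cos2P.contDiff)

/-- Values of `g_β`. [folklore] -/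
@[simp] theorem gP_apply (β t : ℝ) : gP β t = -((β ^ 2 - 2) / 2) + β ^ 2 / 6 * cos2P t := rfl

/-- `g_β″ = −(8/3)π²β² cos 4πt`. [folklore] -/
theorem deriv_deriv_gP (β t : ℝ) : deriv (deriv (gP β)) t = -(16 * π ^ 2) * (β ^ 2 / 6) * cos2P t := by
  have hfun : (gP β : ℝ → ℝ) = fun x => -((β ^ 2 - 2) / 2) + β ^ 2 / 6 * cos2P x := rfl
  have hd1 : deriv (gP β : ℝ → ℝ) = fun x => β ^ 2 / 6 * deriv cos2P x := by
    funext x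
    rw [hfun]
    have h := ((hasDerivAt_cos2P x).const_mul (β ^ 2 / 6)).const_add (-((β ^ 2 - 2) / 2))
    rw [h.deriv, (hasDerivAt_cos2P x).deriv]
  rw [hd1]
  have hdc : deriv (cos2P : ℝ → ℝ) = fun x => -(4 * π * Real.sin (4 * π * x)) :=
    funext fun x => (hasDerivAt_cos2P x).deriv
  have hdiff : DifferentiableAt ℝ (deriv (cos2P : ℝ → ℝ)) t := by
    rw [hdc]
    have h : HasDerivAt (fun x : ℝ => -(4 * π * Real.sin (4 * π * x)))
        (-(4 * π * (Real.cos (4 * π * t) * (4 * π * 1)))) t :=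
      (((hasDerivAt_id t).const_mul (4 * π)).sin.const_mul (4 * π)).neg
    exact h.differentiableAt
  rw [deriv_const_mul _ hdiff, deriv_deriv_cos2P]
  ring

/-- **`g_β″ − 8π² g_β = h_β`** (`h_β = 8π²(β² sin² 2πt − 1) = 4π²(β²−2) − 4π²β² cos 4πt`). [ours] -/
theorem gP_ode (β t : ℝ) :
    deriv (deriv (gP β)) t - 8 * π ^ 2 * gP β t = 8 * π ^ 2 * (β ^ 2 * sinP t ^ 2 - 1) := by
  rw [deriv_deriv_gP, gP_apply, cos2P_apply, sinP_apply]
  have hcos : Real.cos (4 * π * t) = 1 - 2 * Real.sin (2 * π * t) ^ 2 := by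
    rw [show (4 : ℝ) * π * t = 2 * (2 * π * t) by ring, Real.cos_two_mul, Real.cos_sq']
    ring
  rw [hcos]
  ring

/-- `g_β″ − 8π² g_β = h_β` on the circle. [ours] -/
theorem gP_ode_onCircle (β : ℝ) (b : UnitAddCircle) :
    (gP β).D.D.onCircle b - 8 * π ^ 2 * (gP β).onCircle b = heatProfile β b := by
  obtain ⟨t, rfl⟩ := QuotientAddGroup.mk_surjective b
  have h1 := gP_ode β t
  have h2 := heatProfile_eq β t
  simp only [heatProfile, ShearProfile.onCircle_coe, ShearProfile.coe_D] at *
  linarith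

/-- `∫_T g_β = −(β²−2)/2`. [ours] -/
theorem integral_circle_gP (β : ℝ) : ∫ b, (gP β).onCircle b = -((β ^ 2 - 2) / 2) := by
  rw [CellularStretching.integral_circle_eq_intervalIntegral]
  simp only [ShearProfile.onCircle_coe, gP_apply, cos2P_apply]
  have h4π : (4 * π : ℝ) ≠ 0 := by positivity
  have hi : IntervalIntegrable (fun t : ℝ => Real.cos (4 * π * t)) volume 0 1 :=
    (Real.continuous_cos.comp (continuous_const.mul continuous_id)).intervalIntegrable _ _
  rw [intervalIntegral.integral_add intervalIntegrable_const (hi.const_mul _),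
    intervalIntegral.integral_const, intervalIntegral.integral_const_mul,
    intervalIntegral.integral_comp_mul_left (fun x => Real.cos x) h4π, integral_cos]
  simp [show (4 : ℝ) * π = 2 * π + 2 * π by ring, Real.sin_add]

/-! ## 2. `Δ⁻¹(h_β(x₂) cc) = g_β(x₂) cc` -/

/-- The product `G(x) = g_β(x₂) cc(x)`. [ours; bookkeeping] -/
def Gfun (β : ℝ) (x : UnitAddTorus (Fin 3)) : ℝ := (gP β).onCircle (x 2) * cc x

/-- `G` is smooth. [folklore] -/
theorem isSmooth_Gfun (β : ℝ) : IsSmooth (Gfun β) :=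
  (Literature.Analysis.FluidPDE.Torus.DEIJ.isSmooth_onCircle_comp 2 (gP β)).mul isSmooth_cc

/-- `C''` on the circle: `C.D.D.onCircle b = −4π² C.onCircle b`. [folklore] -/
theorem cosP_DD_onCircle (b : UnitAddCircle) : cosP.D.D.onCircle b = -(4 * π ^ 2) * cosP.onCircle b := by
  obtain ⟨t, rfl⟩ := QuotientAddGroup.mk_surjective b
  simp only [ShearProfile.onCircle_coe, ShearProfile.coe_D]
  have hdc : deriv (cosP : ℝ → ℝ) = fun x => -(2 * π * sinP x) := funext fun x => deriv_cosP x
  rw [hdc]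
  have h : HasDerivAt (fun x : ℝ => -(2 * π * sinP x)) (-(2 * π * (2 * π * cosP t))) t :=
    ((hasDerivAt_sinP t).const_mul (2 * π)).neg
  rw [h.deriv]
  ring

/-- `∂₀ (P(x₂) Q(x₀) R(x₁)) = P(x₂) Q'(x₀) R(x₁)`. [folklore] -/
theorem partialDeriv_zero_prod₃ (P Q R : ShearProfile) (x : UnitAddTorus (Fin 3)) :
    Torus.partialDeriv 0 (fun y : UnitAddTorus (Fin 3) => P.onCircle (y 2) * (Q.onCircle (y 0) * R.onCircle (y 1))) x =
      P.onCircle (x 2) * (Q.D.onCircle (x 0) * R.onCircle (x 1)) := by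
  rw [Torus.partialDeriv_mul (isContDiff_onCircle_comp' P 2)
    ((isSmooth_prod₂ Q R 0 1).isContDiff (by simp)), partialDeriv_onCircle_comp', partialDeriv_prod₂]
  have h1 : ¬ ((0 : Fin 3) = 2) := by decide
  have h2 : ¬ ((0 : Fin 3) = 1) := by decide
  simp only [h1, h2, if_false, if_true, zero_mul, mul_zero, add_zero]

/-- `∂₁ (P(x₂) Q(x₀) R(x₁)) = P(x₂) Q(x₀) R'(x₁)`. [folklore] -/
theorem partialDeriv_one_prod₃ (P Q R : ShearProfile) (x : UnitAddTorus (Fin 3)) :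
    Torus.partialDeriv 1 (fun y : UnitAddTorus (Fin 3) => P.onCircle (y 2) * (Q.onCircle (y 0) * R.onCircle (y 1))) x =
      P.onCircle (x 2) * (Q.onCircle (x 0) * R.D.onCircle (x 1)) := by
  rw [Torus.partialDeriv_mul (isContDiff_onCircle_comp' P 2)
    ((isSmooth_prod₂ Q R 0 1).isContDiff (by simp)), partialDeriv_onCircle_comp', partialDeriv_prod₂]
  have h1 : ¬ ((1 : Fin 3) = 2) := by decide
  have h2 : ¬ ((1 : Fin 3) = 0) := by decide
  simp only [h1, h2, if_false, if_true, zero_mul, zero_add, add_zero]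

/-- `∂₂ (P(x₂) Q(x₀) R(x₁)) = P'(x₂) Q(x₀) R(x₁)`. [folklore] -/
theorem partialDeriv_two_prod₃ (P Q R : ShearProfile) (x : UnitAddTorus (Fin 3)) :
    Torus.partialDeriv 2 (fun y : UnitAddTorus (Fin 3) => P.onCircle (y 2) * (Q.onCircle (y 0) * R.onCircle (y 1))) x =
      P.D.onCircle (x 2) * (Q.onCircle (x 0) * R.onCircle (x 1)) := by
  rw [Torus.partialDeriv_mul (isContDiff_onCircle_comp' P 2)
    ((isSmooth_prod₂ Q R 0 1).isContDiff (by simp)), partialDeriv_onCircle_comp', partialDeriv_prod₂]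
  have h1 : ¬ ((2 : Fin 3) = 0) := by decide
  have h2 : ¬ ((2 : Fin 3) = 1) := by decide
  simp only [h1, h2, if_false, if_true, zero_mul, mul_zero, add_zero, zero_add]

/-- **`ΔG = h_β(x₂) cc`**: `Δ(g(x₂)cc) = (g″ − 8π²g)(x₂) cc`. [ours; elementary] -/
theorem laplacian_Gfun (β : ℝ) (x : UnitAddTorus (Fin 3)) : Torus.laplacian (Gfun β) x = heatProfile β (x 2) * cc x := by
  have hG : Gfun β = fun y : UnitAddTorus (Fin 3) => (gP β).onCircle (y 2) * (cosP.onCircle (y 0) * cosP.onCircle (y 1)) := rfl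
  have h0 : Torus.partialDeriv 0 (Gfun β) =
      fun y : UnitAddTorus (Fin 3) => (gP β).onCircle (y 2) * (cosP.D.onCircle (y 0) * cosP.onCircle (y 1)) := by
    funext y; rw [hG]; exact partialDeriv_zero_prod₃ _ _ _ y
  have h1 : Torus.partialDeriv 1 (Gfun β) =
      fun y : UnitAddTorus (Fin 3) => (gP β).onCircle (y 2) * (cosP.onCircle (y 0) * cosP.D.onCircle (y 1)) := by
    funext y; rw [hG]; exact partialDeriv_one_prod₃ _ _ _ y
  have h2 : Torus.partialDeriv 2 (Gfun β) =
      fun y : UnitAddTorus (Fin 3) => (gP β).D.onCircle (y 2) * (cosP.onCircle (y 0) * cosP.onCircle (y 1)) := by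
    funext y; rw [hG]; exact partialDeriv_two_prod₃ _ _ _ y
  rw [Torus.laplacian_eq_sum_partialDeriv_partialDeriv (isSmooth_Gfun β), Fin.sum_univ_three, h0, h1, h2,
    partialDeriv_zero_prod₃, partialDeriv_one_prod₃, partialDeriv_two_prod₃, cosP_DD_onCircle,
    cosP_DD_onCircle, ← gP_ode_onCircle, cc]
  ring

/-- `∫ G = 0`. [folklore] -/
theorem integral_Gfun (β : ℝ) : ∫ x, Gfun β x = 0 := by
  have h := MeasureTheory.integral_fintype_prod_volume_eq_prod (𝕜 := ℝ)
    (![cosP.onCircle, cosP.onCircle, (gP β).onCircle] : Fin 3 → UnitAddCircle → ℝ)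
  have e : (fun x : UnitAddTorus (Fin 3) => ∏ i, (![cosP.onCircle, cosP.onCircle, (gP β).onCircle] :
      Fin 3 → UnitAddCircle → ℝ) i (x i)) = Gfun β := by
    funext x
    rw [Fin.prod_univ_three]
    simp [Gfun, cc]
    ring
  rw [e, Fin.prod_univ_three] at h
  rw [h]
  simp [integral_circle_cosP]

/-- **`Δ⁻¹(h_β(x₂) cc) = g_β(x₂) cc`.** [ours] -/
theorem invLaplacian_heat_cc (β : ℝ) :
    Torus.invLaplacian (fun x : UnitAddTorus (Fin 3) => heatProfile β (x 2) * cc x) = Gfun β := by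
  have hΔ : (fun x : UnitAddTorus (Fin 3) => heatProfile β (x 2) * cc x) = Torus.laplacian (Gfun β) := by
    funext x; rw [laplacian_Gfun]
  rw [hΔ]
  exact Torus.invLaplacian_laplacian_of_integral_eq_zero (isSmooth_Gfun β) (integral_Gfun β)

/-! ## 3. The viscous rate of `∫|π|^q` at the crossed shear -/

/-- `∫ g_β(x₂) (cc²)^{q/2} = (∫g_β) m_q²`, `m_q = ∫_T (cos² 2πt)^{q/2}`. [folklore] -/
theorem integral_gP_mul_cc_rpow (β q : ℝ) :
    ∫ x : UnitAddTorus (Fin 3), (gP β).onCircle (x 2) * (cc x ^ 2) ^ (q / 2) =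
      (∫ b, (gP β).onCircle b) * (∫ b, (cosP.onCircle b ^ 2) ^ (q / 2)) ^ 2 := by
  have h := MeasureTheory.integral_fintype_prod_volume_eq_prod (𝕜 := ℝ)
    (![fun b => (cosP.onCircle b ^ 2) ^ (q / 2), fun b => (cosP.onCircle b ^ 2) ^ (q / 2),
      (gP β).onCircle] : Fin 3 → UnitAddCircle → ℝ)
  have e : (fun x : UnitAddTorus (Fin 3) => ∏ i, (![fun b => (cosP.onCircle b ^ 2) ^ (q / 2),
      fun b => (cosP.onCircle b ^ 2) ^ (q / 2), (gP β).onCircle] : Fin 3 → UnitAddCircle → ℝ) i (x i)) =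
      fun x => (gP β).onCircle (x 2) * (cc x ^ 2) ^ (q / 2) := by
    funext x
    rw [Fin.prod_univ_three]
    simp only [Matrix.cons_val_zero, Matrix.cons_val_one, Matrix.cons_val]
    rw [cc, mul_pow, Real.mul_rpow (sq_nonneg _) (sq_nonneg _)]
    ring
  rw [e, Fin.prod_univ_three] at h
  rw [h]
  simp only [Matrix.cons_val_zero, Matrix.cons_val_one, Matrix.cons_val]
  ring

/-- `m_q = ∫_T (cos² 2πt)^{q/2} > 0` (continuous, non-negative, `= 1` at `t = 0`). [folklore] -/
theorem circle_cos_rpow_pos (q : ℝ) (hq : 0 ≤ q) : 0 < ∫ b, (cosP.onCircle b ^ 2) ^ (q / 2) := by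
  have hc : Continuous fun b : UnitAddCircle => (cosP.onCircle b ^ 2) ^ (q / 2) :=
    (cosP.continuous_onCircle.pow 2).rpow_const fun b => Or.inr (by linarith)
  have h0 : ∀ b, 0 ≤ (cosP.onCircle b ^ 2) ^ (q / 2) := fun b => Real.rpow_nonneg (sq_nonneg _) _
  rw [integral_pos_iff_support_of_nonneg h0 (hc.integrable_of_hasCompactSupport
    (HasCompactSupport.of_compactSpace _))]
  refine (hc.isOpen_support).measure_pos volume ⟨((0 : ℝ) : UnitAddCircle), ?_⟩
  rw [Function.mem_support, ShearProfile.onCircle_coe, cosP_apply]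
  simp

/-- **`V_q(u_β) = 4π² q (β² − 2) m_q²`** for real `q ≥ 2`. [ours] -/
theorem pressureRpowViscousRate_cshear (β : ℝ) {q : ℝ} (hq : 2 ≤ q) :
    pressureRpowViscousRate q (cshear β) =
      4 * π ^ 2 * q * (β ^ 2 - 2) * (∫ b, (cosP.onCircle b ^ 2) ^ (q / 2)) ^ 2 := by
  unfold pressureRpowViscousRate
  rw [pressureOf_cshear]
  have hsrc : pressureSqViscousSource (cshear β) = (-(8 * π ^ 2)) • fun x => heatProfile β (x 2) * cc x := by
    funext x; rw [pressureSqViscousSource_cshear]; simp [smul_eq_mul]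
  have hsm : IsSmooth (fun x : UnitAddTorus (Fin 3) => heatProfile β (x 2) * cc x) := by
    have e : (fun x : UnitAddTorus (Fin 3) => heatProfile β (x 2) * cc x) = Torus.laplacian (Gfun β) := by
      funext x; rw [laplacian_Gfun]
    rw [e]; exact (isSmooth_Gfun β).laplacian
  rw [hsrc, Torus.invLaplacian_const_smul _ _ hsm, invLaplacian_heat_cc]
  have e2 : ∀ x : UnitAddTorus (Fin 3), q * (cc x * (cc x ^ 2) ^ (q / 2 - 1)) * ((-(8 * π ^ 2)) • Gfun β) x =
      (-(8 * π ^ 2) * q) * ((gP β).onCircle (x 2) * (cc x ^ 2) ^ (q / 2)) := by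
    intro x
    rw [Pi.smul_apply, smul_eq_mul, Gfun]
    have hpow : cc x * (cc x ^ 2) ^ (q / 2 - 1) * cc x = (cc x ^ 2) ^ (q / 2) := by
      have h1 : (cc x ^ 2) ^ (q / 2) = (cc x ^ 2) ^ ((1 : ℝ) + (q / 2 - 1)) := by congr 1; ring
      rw [h1, Real.rpow_add' (sq_nonneg _) (by linarith), Real.rpow_one]
      ring
    calc q * (cc x * (cc x ^ 2) ^ (q / 2 - 1)) * (-(8 * π ^ 2) * ((gP β).onCircle (x 2) * cc x))
        = (-(8 * π ^ 2) * q) * ((gP β).onCircle (x 2) * (cc x * (cc x ^ 2) ^ (q / 2 - 1) * cc x)) := by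
          ring
      _ = (-(8 * π ^ 2) * q) * ((gP β).onCircle (x 2) * (cc x ^ 2) ^ (q / 2)) := by rw [hpow]
  simp_rw [e2]
  rw [integral_const_mul, integral_gP_mul_cc_rpow, integral_circle_gP]
  ring

/-! ## 4. The no-go for every real `q ≥ 2` -/

/-- **Kernel no-go (SIEVELD §1–§2): `∫|p|^q` obeys NO saturating law, real `q ≥ 2`.** For every `κ`,
every `σ` and every `γ ≥ 0`, `SaturatingLaw (torusPressureMoment q) σ γ κ` fails on `T³` — at the
crossed shear `u₂` the viscous initial rate of `∫|π|^q` is `V_q = 8π² q m_q² > 0`. In particular the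
K0 rows `EP.p.q=2|T_LD|G1` (`σ=1, γ=5`) and `EP.p.q=3|T_LD|G1` (`σ=3, γ=3`) are FALSE for every κ.
Search for candidate a priori estimates; no regularity claim. [ours; SIEVELD §1 Thm H, §2 Cor. W11] -/
theorem not_saturatingLaw_pressureMoment_rpow {q : ℝ} (hq : 2 ≤ q) {σ γ : ℝ} (hγ : 0 ≤ γ) (κ : ℝ) :
    ¬ SaturatingLaw (d := Fin 3) (torusPressureMoment q) σ γ κ := by
  have hm := circle_cos_rpow_pos q (by linarith)
  have hV : 0 < pressureRpowViscousRate q (cshear 2) := by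
    rw [pressureRpowViscousRate_cshear 2 hq]
    have hπ2 : (0 : ℝ) < π ^ 2 := by positivity
    have : (0 : ℝ) < 4 * π ^ 2 * q * ((2 : ℝ) ^ 2 - 2) := by nlinarith
    exact mul_pos this (pow_pos hm 2)
  exact not_saturatingLaw_of_viscousRate_pos (hasInitialRate_torusPressureMoment_rpow hq) (by simp)
    (isSmooth_cshear 2) (isDivFree_cshear 2) (hasZeroMean_cshear 2) hV hγ κ

/-- **Row `EP.p.q=3|T_LD|G1` (K0: `σ_F = 3`, `γ_F = 3`) is FALSE for every κ.** [ours] -/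
theorem not_saturatingLaw_pressureMoment_three_row (κ : ℝ) :
    ¬ SaturatingLaw (d := Fin 3) (torusPressureMoment 3) 3 3 κ :=
  not_saturatingLaw_pressureMoment_rpow (by norm_num) (by norm_num) κ

end CrossedShear

end Summit.NavierStokesRegularity.FunctionalMining
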